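import Literature.NumberTheory.Transcendental.ManyCurvePeriodsIsotypicProofs

/-!
# `RealOnePeriodRelations` (stmt-KontsevichZagierPeriods-10042), line `nash-retraction-thin-strip`,
# log–loop layer: stub `stub_logsIsotypicSplitting`

ISOGENIES ALLOWED: THE ISOTYPIC SPLITTING WITH LOGARITHMS, from the pairwise non-isogenous
statement (Baker + Huber–Wüstholz 15.3 (1) jointly for pairwise non-isogenous lattices and
`ℚ`-independent logarithms of algebraic numbers).  For ANY lattices `Λ₁, …, Λ_k` with algebraic
invariants (complex multiplication and isogenies allowed) and `ℚ`-independent logarithms `y_j` of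
algebraic numbers, a vanishing algebraic combination
`α + Σ_j μ_j y_j + Σ_i (a_i ω₁⁽ⁱ⁾ + b_i ω₂⁽ⁱ⁾ + c_i η₁⁽ⁱ⁾ + d_i η₂⁽ⁱ⁾) = 0` has `α = 0`, every
`μ_j = 0`, and for every `i` the block of its ISOGENY CLASS `S = {j | Λ_i ~ Λ_j}` vanishes.

The proof is the isogeny transport of `HuberWustholzIsotypicSplitting_of_manyCurvePeriods`
(`Literature/NumberTheory/Transcendental/ManyCurvePeriodsIsotypicProofs.lean`) verbatim, with the
logarithmic term `Σ_j μ_j y_j` riding along: the least representative `r(j)` of each isogeny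
class, `IsotypicSplitting.exists_algebraic_transition` term by term (the four numbers of `Λ_j` are
an algebraic combination of the four numbers of `Λ_{r(j)}`), regrouping along the fibres of `r`,
reindexing the representatives by `Fin m`, and the hypothesis for the PAIRWISE NON-ISOGENOUS
family of representatives with the same `ι, y, μ`; the isogeny class of `i` is the fibre of `r(i)`.

[cite: HuberWustholz2022, Thm 15.3 (1), §15.2.2 Lemma 15.8 / Prop. 15.9, Rem. 8.2]
[cite: BakerWustholz2007, §6.2 p. 95, p. 98]
-/

noncomputable section

open Complex
open Literature.NumberTheory.Transcendental

namespace Summit.KontsevichZagierPeriods.SymplecticScissors.RealOnePeriodRelations.LogLoopLayer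

open IsotypicSplitting in
/-- **ISOGENIES ALLOWED: THE ISOTYPIC SPLITTING WITH LOGARITHMS**, from the pairwise
non-isogenous statement (the hypothesis: Baker + Huber–Wüstholz 15.3 (1) jointly).  For ANY
lattices `Λ₁, …, Λ_k` with algebraic invariants and `ℚ`-independent logarithms `y_j` of algebraic
numbers, a vanishing algebraic combination
`α + Σ_j μ_j y_j + Σ_i (a_i ω₁⁽ⁱ⁾ + b_i ω₂⁽ⁱ⁾ + c_i η₁⁽ⁱ⁾ + d_i η₂⁽ⁱ⁾) = 0` has `α = 0`, every
`μ_j = 0`, and for every `i` the block of its ISOGENY CLASS `S = {j | Λ_i ~ Λ_j}` vanishes.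
Route: `HuberWustholzIsotypicSplitting_of_manyCurvePeriods` verbatim with the extra term
`Σ μ_j y_j` riding along — least representatives `r(j)` of the classes,
`IsotypicSplitting.exists_algebraic_transition` term by term, regrouping along the fibres of `r`
(`Finset.sum_fiberwise_of_maps_to`), the hypothesis for the pairwise non-isogenous family of
representatives (reindexed by `Fin m` through `Finset.equivFin`) with the same `ι, y, μ`.
[cite: HuberWustholz2022, Thm 15.3 (1), §15.2.2 Lemma 15.8 / Prop. 15.9, Rem. 8.2]
[cite: BakerWustholz2007, §6.2 p. 95, p. 98] -/
theorem stub_logsIsotypicSplitting :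
    (∀ (k : ℕ) (L : Fin k → PeriodPair),
      (∀ i, IsAlgebraic ℚ (L i).g₂ ∧ IsAlgebraic ℚ (L i).g₃) →
      (∀ i j, i ≠ j → ¬ (L i).IsIsogenousTo (L j)) →
      ∀ (ι : Type) [Fintype ι] (y : ι → ℂ), (∀ j, IsAlgebraic ℚ (Complex.exp (y j))) → LinearIndependent ℚ y →
      ∀ (α : ℂ) (μ : ι → ℂ) (a b c d : Fin k → ℂ), IsAlgebraic ℚ α → (∀ j, IsAlgebraic ℚ (μ j)) →
        (∀ i, IsAlgebraic ℚ (a i) ∧ IsAlgebraic ℚ (b i) ∧ IsAlgebraic ℚ (c i) ∧ IsAlgebraic ℚ (d i)) →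
        α + ∑ j, μ j * y j + ∑ i, (a i * (L i).ω₁ + b i * (L i).ω₂ + c i * (L i).η₁ + d i * (L i).η₂) = 0 →
          α = 0 ∧ (∀ j, μ j = 0) ∧
            (∀ i, a i * (L i).ω₁ + b i * (L i).ω₂ + c i * (L i).η₁ + d i * (L i).η₂ = 0) ∧
            (∀ i, ¬ (L i).HasCM → a i = 0 ∧ b i = 0 ∧ c i = 0 ∧ d i = 0)) →
    ∀ (k : ℕ) (L : Fin k → PeriodPair),
      (∀ i, IsAlgebraic ℚ (L i).g₂ ∧ IsAlgebraic ℚ (L i).g₃) →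
      ∀ (ι : Type) [Fintype ι] (y : ι → ℂ), (∀ j, IsAlgebraic ℚ (Complex.exp (y j))) → LinearIndependent ℚ y →
      ∀ (α : ℂ) (μ : ι → ℂ) (a b c d : Fin k → ℂ), IsAlgebraic ℚ α → (∀ j, IsAlgebraic ℚ (μ j)) →
        (∀ i, IsAlgebraic ℚ (a i) ∧ IsAlgebraic ℚ (b i) ∧ IsAlgebraic ℚ (c i) ∧ IsAlgebraic ℚ (d i)) →
        α + ∑ j, μ j * y j + ∑ i, (a i * (L i).ω₁ + b i * (L i).ω₂ + c i * (L i).η₁ + d i * (L i).η₂) = 0 →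
          α = 0 ∧ (∀ j, μ j = 0) ∧
            ∀ (i : Fin k) (S : Finset (Fin k)), (∀ j, j ∈ S ↔ (L i).IsIsogenousTo (L j)) →
              ∑ j ∈ S, (a j * (L j).ω₁ + b j * (L j).ω₂ + c j * (L j).η₁ + d j * (L j).η₂) = 0 := by
  -- adapted from `HuberWustholzIsotypicSplitting_of_manyCurvePeriods`
  -- (Literature/NumberTheory/Transcendental/ManyCurvePeriodsIsotypicProofs.lean)
  intro hMany k L hL ι _ y hy hli α μ a b c d hα hμ habcd hsum
  classical
  -- the isogeny class of `i` inside `Fin k`, and its least element `r i` (the representative)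
  let cls : Fin k → Finset (Fin k) := fun i =>
    Finset.univ.filter fun j => (L i).IsIsogenousTo (L j)
  have hcls_mem : ∀ i j, j ∈ cls i ↔ (L i).IsIsogenousTo (L j) := fun i j => by simp [cls]
  have hcls_ne : ∀ i, (cls i).Nonempty := fun i =>
    ⟨i, (hcls_mem i i).2 (PeriodPair.isIsogenousTo_refl _)⟩
  have hcls_eq : ∀ i j, (L i).IsIsogenousTo (L j) → cls i = cls j := by
    intro i j hij
    ext x
    rw [hcls_mem, hcls_mem]
    exact ⟨fun h => hij.symm.trans h, fun h => hij.trans h⟩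
  let r : Fin k → Fin k := fun i => (cls i).min' (hcls_ne i)
  have hr_mem : ∀ i, r i ∈ cls i := fun i => Finset.min'_mem _ _
  have hr_le : ∀ i, ∀ x ∈ cls i, r i ≤ x := fun i x hx => Finset.min'_le _ _ hx
  have hr_iso : ∀ i, (L i).IsIsogenousTo (L (r i)) := fun i => (hcls_mem i _).1 (hr_mem i)
  have hr_eq : ∀ i j, (L i).IsIsogenousTo (L j) → r i = r j := by
    intro i j hij
    have h := hcls_eq i j hij
    apply le_antisymm
    · refine hr_le i _ ?_
      rw [h]
      exact hr_mem j
    · refine hr_le j _ ?_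
      rw [← h]
      exact hr_mem i
  have hr_idem : ∀ i, r (r i) = r i := fun i => (hr_eq i (r i) (hr_iso i)).symm
  have hr_of_eq : ∀ i j, r i = r j → (L i).IsIsogenousTo (L j) := by
    intro i j h
    have h' : (L (r i)).IsIsogenousTo (L j) := by
      rw [h]
      exact (hr_iso j).symm
    exact (hr_iso i).trans h'
  -- every term rewritten through the four numbers of its representative
  have htrans : ∀ j, ∃ A B C D : ℂ, IsAlgebraic ℚ A ∧ IsAlgebraic ℚ B ∧ IsAlgebraic ℚ C ∧
      IsAlgebraic ℚ D ∧
      a j * (L j).ω₁ + b j * (L j).ω₂ + c j * (L j).η₁ + d j * (L j).η₂ =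
        A * (L (r j)).ω₁ + B * (L (r j)).ω₂ + C * (L (r j)).η₁ + D * (L (r j)).η₂ := fun j =>
    exists_algebraic_transition (hr_iso j) (hL j).1 (hL j).2 (hL (r j)).1 (hL (r j)).2
      (habcd j).1 (habcd j).2.1 (habcd j).2.2.1 (habcd j).2.2.2
  choose A B C D hA hB hC hD hT using htrans
  -- the fibres of `r` and the per-representative coefficients
  let fib : Fin k → Finset (Fin k) := fun ρ => Finset.univ.filter fun j => r j = ρ
  let A' : Fin k → ℂ := fun ρ => ∑ j ∈ fib ρ, A j
  let B' : Fin k → ℂ := fun ρ => ∑ j ∈ fib ρ, B j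
  let C' : Fin k → ℂ := fun ρ => ∑ j ∈ fib ρ, C j
  let D' : Fin k → ℂ := fun ρ => ∑ j ∈ fib ρ, D j
  have hA' : ∀ ρ, IsAlgebraic ℚ (A' ρ) := fun ρ =>
    CurvePeriods.isAlgebraic_finsetSum _ _ fun j _ => hA j
  have hB' : ∀ ρ, IsAlgebraic ℚ (B' ρ) := fun ρ =>
    CurvePeriods.isAlgebraic_finsetSum _ _ fun j _ => hB j
  have hC' : ∀ ρ, IsAlgebraic ℚ (C' ρ) := fun ρ =>
    CurvePeriods.isAlgebraic_finsetSum _ _ fun j _ => hC j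
  have hD' : ∀ ρ, IsAlgebraic ℚ (D' ρ) := fun ρ =>
    CurvePeriods.isAlgebraic_finsetSum _ _ fun j _ => hD j
  -- the block of a fibre is a combination of the four numbers of the representative
  have hblk : ∀ ρ, ∑ j ∈ fib ρ, (a j * (L j).ω₁ + b j * (L j).ω₂ + c j * (L j).η₁ +
      d j * (L j).η₂) =
      A' ρ * (L ρ).ω₁ + B' ρ * (L ρ).ω₂ + C' ρ * (L ρ).η₁ + D' ρ * (L ρ).η₂ := by
    intro ρ
    have h : ∀ j ∈ fib ρ, a j * (L j).ω₁ + b j * (L j).ω₂ + c j * (L j).η₁ + d j * (L j).η₂ =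
        A j * (L ρ).ω₁ + B j * (L ρ).ω₂ + C j * (L ρ).η₁ + D j * (L ρ).η₂ := by
      intro j hj
      have hj' : r j = ρ := (Finset.mem_filter.mp hj).2
      rw [hT j, hj']
    rw [Finset.sum_congr rfl h]
    simp only [A', B', C', D', Finset.sum_add_distrib, Finset.sum_mul]
  -- the set of representatives; `r` fixes it pointwise
  set R : Finset (Fin k) := Finset.univ.image r with hR
  have hR_mem : ∀ i, r i ∈ R := fun i => Finset.mem_image_of_mem r (Finset.mem_univ i)
  have hR_fix : ∀ ρ ∈ R, r ρ = ρ := by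
    intro ρ hρ
    obtain ⟨i, -, rfl⟩ := Finset.mem_image.mp hρ
    exact hr_idem i
  -- the sum regrouped along the fibres of `r`
  have hregroup : ∑ j, (a j * (L j).ω₁ + b j * (L j).ω₂ + c j * (L j).η₁ + d j * (L j).η₂) =
      ∑ ρ ∈ R, (A' ρ * (L ρ).ω₁ + B' ρ * (L ρ).ω₂ + C' ρ * (L ρ).η₁ + D' ρ * (L ρ).η₂) := by
    rw [← Finset.sum_fiberwise_of_maps_to (s := Finset.univ) (t := R) (g := r)
      (fun i _ => hR_mem i)]
    exact Finset.sum_congr rfl fun ρ _ => hblk ρ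
  -- the pairwise non-isogenous family of representatives, indexed by `Fin m`
  set m : ℕ := R.card with hm
  set e : ↥R ≃ Fin m := R.equivFin with he
  set ρ' : Fin m → Fin k := fun t => ((e.symm t : ↥R) : Fin k) with hρ'
  set F : Fin m → PeriodPair := fun t => L (ρ' t) with hF
  have hρ'R : ∀ t, ρ' t ∈ R := fun t => (e.symm t).2
  have hρ'inj : Function.Injective ρ' := fun t t' h => e.symm.injective (Subtype.ext h)
  have hFalg : ∀ t, IsAlgebraic ℚ (F t).g₂ ∧ IsAlgebraic ℚ (F t).g₃ := fun t => hL _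
  have hFiso : ∀ t t', t ≠ t' → ¬ (F t).IsIsogenousTo (F t') := by
    intro t t' htt' hiso
    apply htt'
    apply hρ'inj
    have h := hr_eq _ _ hiso
    rwa [hR_fix _ (hρ'R t), hR_fix _ (hρ'R t')] at h
  have hsumR : ∑ ρ ∈ R, (A' ρ * (L ρ).ω₁ + B' ρ * (L ρ).ω₂ + C' ρ * (L ρ).η₁ + D' ρ * (L ρ).η₂) =
      ∑ t, (A' (ρ' t) * (F t).ω₁ + B' (ρ' t) * (F t).ω₂ + C' (ρ' t) * (F t).η₁ +
        D' (ρ' t) * (F t).η₂) := by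
    rw [← Finset.sum_coe_sort R]
    exact (Equiv.sum_comp e.symm (fun x : ↥R => A' x * (L x).ω₁ + B' x * (L x).ω₂ +
      C' x * (L x).η₁ + D' x * (L x).η₂)).symm
  have hsum' : α + ∑ j, μ j * y j +
      ∑ t, (A' (ρ' t) * (F t).ω₁ + B' (ρ' t) * (F t).ω₂ + C' (ρ' t) * (F t).η₁ +
        D' (ρ' t) * (F t).η₂) = 0 := by
    rw [← hsumR, ← hregroup]
    exact hsum
  -- the pairwise non-isogenous instance, with the same `ι, y, μ`
  obtain ⟨hα0, hμ0, hblock, -⟩ := hMany m F hFalg hFiso ι y hy hli α μ (fun t => A' (ρ' t))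
    (fun t => B' (ρ' t)) (fun t => C' (ρ' t)) (fun t => D' (ρ' t)) hα hμ
    (fun t => ⟨hA' _, hB' _, hC' _, hD' _⟩) hsum'
  refine ⟨hα0, hμ0, fun i S hS => ?_⟩
  -- the isogeny class of `i` is the fibre of its representative `r i`
  have hSfib : S = fib (r i) := by
    ext j
    rw [hS j]
    simp only [fib, Finset.mem_filter, Finset.mem_univ, true_and]
    exact ⟨fun h => (hr_eq i j h).symm, fun h => hr_of_eq i j h.symm⟩
  rw [hSfib, hblk (r i)]
  have ht := hblock (e ⟨r i, hR_mem i⟩)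
  simpa [hF, hρ'] using ht

end Summit.KontsevichZagierPeriods.SymplecticScissors.RealOnePeriodRelations.LogLoopLayer

end
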